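import Summits.CriticalPhenomena.PercolationContinuityZ3.Theorems.PercNearOneGluingNoHeavyQuantLightPairBlobForest
import HarnessLib

/-!
# QUANT lane R8, T-DEC: THE LIGHT GLUED PAIR BY FIVE UNGATED BLOB FORESTS, BOUNDARY-SIDE BAND — closed-form certificate for
# `T = (R¹[q](R^c[s]))²` on the explicit region `R_BFtop(c)` (pattern `J` of census-2 g77's exact LP map; complementary to pattern `I`)

builds on p205010 (kernel theorem, internal audit signed; external expert review pending)

Support file (`--supports stmt-CriticalPhenomena-4575`), QUANT lane census seat prim-quant-census-2 (gen 77), rung R8 of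
`run/shared/lean/prim/quant/LADDER.md`.  Theorems only (no definition, no conjecture); standard axioms, no sorries.  Sequel of
`…QuantLightPairBlobForest` / `…Low` / `…Mid` / `…Left` (patterns `M`, `H`, `I`, `G`).

WHAT.  With `T = 2q(1+cs)` (the mean) and floor `y = qs`:
  `T = w₀·blob(2c+2, T/(2c+2)) + w₃·[δ₁ ∗ blob(2c+1, (T−1)/(2c+1))] + w₄·[δ₂ ∗ blob(c, (T−2)/c)] + w₅·blob(c+1, T/(c+1)) + w₆·blob(c+2, T/(c+2))`,
  `w₃ = 2q(1−q)(1−s)(2c+1)/(2c+2−T)`, `w₄ = q²(1−s)²c/(c+2−T)`, `w₅ = 2q(1−q)s(c+1)/T`,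
  `w₆ = (c+2)q²(1−s)[2s(c+2−T) − (1−s)(T−2)]/(T(c+2−T))`, `w₀ = (2c+2)q[qs²(2c+2−T) − 2(1−q)(1−s)(T−1)]/(T(2c+2−T))`
— valid EXACTLY on `R_BFtop(c) = { 1 ≤ c, 1/2 < q < 1, 0 < s < 1, T ≤ c+1, qs ≤ 2q−1, 2(1−q) ≤ cqs, w₆ ≥ 0, w₀ ≥ 0 }` (exact scan, 0 mismatches
between the inequality list, the certificate checker and the LP on 14 696 grid points, `c ∈ {2,…,20}`); the last inequality is the REVERSE of pattern
`I`'s `w₂ ≥ 0`, so `I ∪ J` tile `{T ≤ c+1, qs ≤ 2q−1, 2(1−q) ≤ cqs}` up to the two `B0`-weight conditions; e.g. `c = 4`: `q = .7, s ∈ [.5, .57]`;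
`q = .75, s ∈ [.45, .52]`; `q = .8, s ≈ .45` — the band nearest the heavy boundary for `q ≤ .8`.
* `lpT_eq_bfTopMix` (pointwise identity off the poles); **`lpT_inGatedCatHull_bfTop`**; `_below`, `sdec_lpT_bfTop`, **`treeBuiltCatHull_lpT_bfTop`**.
HONEST STATUS.  Instances on an explicit region only; `TreeBuiltCatHullLight`, `CatPairLight`, `SiblingStep`, `FarTreeRow` remain OPEN; RATE class
log\* / honest sentence of `run/shared/lean/prim/quant/README.md` unchanged.  [this work]; `lpT`: prim-quant-census-2 g76.  Nothing here is cited as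
a published result.  The gluing rows served [cite: KozmaNitzan2024, Conjecture 3 (p. 15)]; product measure [cite: Grimmett1999, §1.3 p. 10].
-/

noncomputable section

open scoped BigOperators

namespace Summit.CriticalPhenomena.PercolationContinuityZ3.Theorems
namespace Quant
namespace LawDec

open Finset

/-! ### The closed-form identity -/

/-- **THE IDENTITY OF PATTERN `J`** (pointwise; `c ≠ 0`, off the poles `T ≠ 0, c+2, 2c+2`; `T = 2q(1+cs)`). [this work] -/
theorem lpT_eq_bfTopMix (c : ℕ) (q s : ℝ) (hc0 : (c : ℝ) ≠ 0) (hT0 : 2 * q * (1 + c * s) ≠ 0) (hW : 2 * c + 2 - 2 * q * (1 + c * s) ≠ 0)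
    (hV : (c : ℝ) + 2 - 2 * q * (1 + c * s) ≠ 0) (h : ℕ) :
    lpT c q s h =
      ((2 * c + 2) * q * (q * s ^ 2 * (2 * c + 2 - 2 * q * (1 + c * s)) - 2 * (1 - q) * (1 - s) * (2 * q * (1 + c * s) - 1)) /
            (2 * q * (1 + c * s) * (2 * c + 2 - 2 * q * (1 + c * s)))) *
          blobLaw [(2 * c + 2, 2 * q * (1 + c * s) / (2 * c + 2))] h +
        (2 * q * (1 - q) * (1 - s) * (2 * c + 1) / (2 * c + 2 - 2 * q * (1 + c * s))) *
          blobLaw [(2 * c + 1, (2 * q * (1 + c * s) - 1) / (2 * c + 1)), (1, 1)] h +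
        (q ^ 2 * (1 - s) ^ 2 * c / (c + 2 - 2 * q * (1 + c * s))) * blobLaw [(c, (2 * q * (1 + c * s) - 2) / c), (2, 1)] h +
        (2 * q * (1 - q) * s * (c + 1) / (2 * q * (1 + c * s))) * blobLaw [(c + 1, 2 * q * (1 + c * s) / (c + 1))] h +
        ((c + 2) * q ^ 2 * (1 - s) * (2 * s * (c + 2 - 2 * q * (1 + c * s)) - (1 - s) * (2 * q * (1 + c * s) - 2)) /
            (2 * q * (1 + c * s) * (c + 2 - 2 * q * (1 + c * s)))) *
          blobLaw [(c + 2, 2 * q * (1 + c * s) / (c + 2))] h := by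
  have hc1 : (c : ℝ) + 1 ≠ 0 := by positivity
  have hc2 : (2 : ℝ) * c + 1 ≠ 0 := by positivity
  have hc3 : (c : ℝ) + 2 ≠ 0 := by positivity
  have hc4 : (2 : ℝ) * c + 2 ≠ 0 := by positivity
  rw [lpT_apply, blobLaw_one_apply, blobLaw_pair_sure_apply, blobLaw_pair_sure_apply, blobLaw_one_apply, blobLaw_one_apply,
    show 2 * c + 1 + 1 = 2 * c + 2 by ring]
  generalize eT : 2 * q * (1 + (c : ℝ) * s) = T at hT0 hW hV ⊢
  generalize eW : (2 : ℝ) * c + 2 - T = W at hW ⊢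
  generalize eV : (c : ℝ) + 2 - T = V at hV ⊢
  field_simp
  subst eW eV eT
  ring

/-- the five weights of pattern `J` sum to `1` (off the poles). [this work] -/
theorem bfTop_wsum (c : ℕ) (q s : ℝ) (hT0 : 2 * q * (1 + c * s) ≠ 0) (hW : (2 : ℝ) * c + 2 - 2 * q * (1 + c * s) ≠ 0)
    (hV : (c : ℝ) + 2 - 2 * q * (1 + c * s) ≠ 0) :
    (2 * c + 2) * q * (q * s ^ 2 * (2 * c + 2 - 2 * q * (1 + c * s)) - 2 * (1 - q) * (1 - s) * (2 * q * (1 + c * s) - 1)) /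
          (2 * q * (1 + c * s) * (2 * c + 2 - 2 * q * (1 + c * s))) +
        2 * q * (1 - q) * (1 - s) * (2 * c + 1) / (2 * c + 2 - 2 * q * (1 + c * s)) +
        q ^ 2 * (1 - s) ^ 2 * c / (c + 2 - 2 * q * (1 + c * s)) + 2 * q * (1 - q) * s * (c + 1) / (2 * q * (1 + c * s)) +
        (c + 2) * q ^ 2 * (1 - s) * (2 * s * (c + 2 - 2 * q * (1 + c * s)) - (1 - s) * (2 * q * (1 + c * s) - 2)) /
          (2 * q * (1 + c * s) * (c + 2 - 2 * q * (1 + c * s))) = 1 := by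
  generalize eT : 2 * q * (1 + (c : ℝ) * s) = T at hT0 hW hV ⊢
  generalize eW : (2 : ℝ) * c + 2 - T = W at hW ⊢
  generalize eV : (c : ℝ) + 2 - T = V at hV ⊢
  field_simp
  subst eW eV eT
  ring

/-! ### Membership on the region `R_BFtop(c)` -/

/-- **THE LIGHT GLUED PAIR IS IN THE HULL ON `R_BFtop(c)`**: for `1 ≤ c`, `1/2 < q < 1`, `0 < s < 1` with `T := 2q(1+cs) ≤ c + 1`,
`qs ≤ 2q − 1`, `2(1−q) ≤ c·qs`, `(1−s)(T−2) ≤ 2s(c+2−T)` and `2(1−q)(1−s)(T−1) ≤ qs²(2c+2−T)`: `InGatedCatHull (qs) T (2c+2) (lpT c q s)`.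
[this work] -/
theorem lpT_inGatedCatHull_bfTop (c : ℕ) (q s : ℝ) (hc : 1 ≤ c) (hq : 1 / 2 < q) (hq1 : q < 1) (hs0 : 0 < s) (hs1 : s < 1)
    (hT : 2 * q * (1 + c * s) ≤ c + 1) (hB : q * s ≤ 2 * q - 1) (hE : 2 * (1 - q) ≤ c * (q * s))
    (hw2 : (1 - s) * (2 * q * (1 + c * s) - 2) ≤ 2 * s * (c + 2 - 2 * q * (1 + c * s)))
    (hw6 : 2 * (1 - q) * (1 - s) * (2 * q * (1 + c * s) - 1) ≤ q * s ^ 2 * (2 * c + 2 - 2 * q * (1 + c * s))) :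
    InGatedCatHull (q * s) (2 * q * (1 + c * s)) (2 * c + 2) (lpT c q s) := by
  have hc0' : (0 : ℝ) < c := by exact_mod_cast hc
  have hc0 : (c : ℝ) ≠ 0 := hc0'.ne'
  have hq0 : 0 < q := by linarith
  have hy0 : 0 < q * s := by nlinarith
  have hy1 : q * s < 1 := by nlinarith
  set T := 2 * q * (1 + c * s) with hTdef
  have hT1 : 1 < T := by
    have : 0 < 2 * q * (c * s) := by positivity
    rw [hTdef]; nlinarith
  have hV : 0 < (c : ℝ) + 2 - T := by linarith
  have hW1 : 0 < T - 1 := by linarith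
  have hTpos : 0 < T := by linarith
  have hW : 0 < (2 : ℝ) * c + 2 - T := by
    have : (c : ℝ) + 1 ≤ 2 * c + 2 := by linarith [hc0'.le]
    linarith
  have m0 : InGatedCatHull (q * s) T (2 * c + 2) (blobLaw [(2 * c + 2, T / (2 * c + 2))]) := by
    have hc4 : (0 : ℝ) < 2 * c + 2 := by positivity
    have g := inGatedCatHull_blobLaw (q * s) hy0 hy1 [(2 * c + 2, T / (2 * c + 2))] (fun p hp => by
      simp only [List.mem_cons, List.not_mem_nil, or_false] at hp
      subst hp
      refine ⟨?_, ?_⟩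
      · show q * s ≤ T / (2 * c + 2)
        rw [le_div_iff₀ hc4, hTdef]; nlinarith
      · show T / (2 * c + 2) ≤ 1
        rw [div_le_one hc4]; linarith) (M := 2 * c + 2) (by simp only [blobTop]; omega)
    have e : blobMean [(2 * c + 2, T / (2 * c + 2))] = T := by simp only [blobMean]; push_cast; field_simp; ring
    rwa [e] at g
  have m3 : InGatedCatHull (q * s) T (2 * c + 2) (blobLaw [(2 * c + 1, (T - 1) / (2 * c + 1)), (1, 1)]) := by
    have hc2 : (0 : ℝ) < 2 * c + 1 := by positivity
    have g := inGatedCatHull_blobLaw (q * s) hy0 hy1 [(2 * c + 1, (T - 1) / (2 * c + 1)), (1, 1)] (fun p hp => by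
      simp only [List.mem_cons, List.not_mem_nil, or_false] at hp
      rcases hp with rfl | rfl
      · refine ⟨?_, ?_⟩
        · show q * s ≤ (T - 1) / (2 * c + 1)
          rw [le_div_iff₀ hc2, hTdef]; nlinarith
        · show (T - 1) / (2 * c + 1) ≤ 1
          rw [div_le_one hc2]; linarith
      · exact ⟨hy1.le, le_rfl⟩) (M := 2 * c + 2) (by simp only [blobTop]; omega)
    have e : blobMean [(2 * c + 1, (T - 1) / (2 * c + 1)), (1, 1)] = T := by
      simp only [blobMean]; push_cast; field_simp; ring
    rwa [e] at g
  have m4 : InGatedCatHull (q * s) T (2 * c + 2) (blobLaw [(c, (T - 2) / c), (2, 1)]) := by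
    have g := inGatedCatHull_blobLaw (q * s) hy0 hy1 [(c, (T - 2) / c), (2, 1)] (fun p hp => by
      simp only [List.mem_cons, List.not_mem_nil, or_false] at hp
      rcases hp with rfl | rfl
      · refine ⟨?_, ?_⟩
        · rw [le_div_iff₀ hc0']; rw [hTdef]; nlinarith
        · rw [div_le_one hc0']; linarith
      · exact ⟨hy1.le, le_rfl⟩) (M := 2 * c + 2) (by simp only [blobTop]; omega)
    have e : blobMean [(c, (T - 2) / c), (2, 1)] = T := by simp only [blobMean]; push_cast; field_simp; ring
    rwa [e] at g
  have m5 : InGatedCatHull (q * s) T (2 * c + 2) (blobLaw [(c + 1, T / (c + 1))]) := by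
    have hc1 : (0 : ℝ) < c + 1 := by positivity
    have g := inGatedCatHull_blobLaw (q * s) hy0 hy1 [(c + 1, T / (c + 1))] (fun p hp => by
      simp only [List.mem_cons, List.not_mem_nil, or_false] at hp
      subst hp
      refine ⟨?_, ?_⟩
      · show q * s ≤ T / (c + 1)
        rw [le_div_iff₀ hc1, hTdef]; nlinarith
      · show T / (c + 1) ≤ 1
        rw [div_le_one hc1]; linarith) (M := 2 * c + 2) (by simp only [blobTop]; omega)
    have e : blobMean [(c + 1, T / (c + 1))] = T := by simp only [blobMean]; push_cast; field_simp; ring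
    rwa [e] at g
  have m6 : InGatedCatHull (q * s) T (2 * c + 2) (blobLaw [(c + 2, T / (c + 2))]) := by
    have hc2 : (0 : ℝ) < c + 2 := by positivity
    have g := inGatedCatHull_blobLaw (q * s) hy0 hy1 [(c + 2, T / (c + 2))] (fun p hp => by
      simp only [List.mem_cons, List.not_mem_nil, or_false] at hp
      subst hp
      refine ⟨?_, ?_⟩
      · show q * s ≤ T / (c + 2)
        rw [le_div_iff₀ hc2, hTdef]; nlinarith
      · show T / (c + 2) ≤ 1
        rw [div_le_one hc2]; linarith) (M := 2 * c + 2) (by simp only [blobTop]; omega)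
    have e : blobMean [(c + 2, T / (c + 2))] = T := by simp only [blobMean]; push_cast; field_simp; ring
    rwa [e] at g
  refine InGatedCatHull.mix5
    ((2 * c + 2) * q * (q * s ^ 2 * (2 * c + 2 - T) - 2 * (1 - q) * (1 - s) * (T - 1)) / (T * (2 * c + 2 - T)))
    (2 * q * (1 - q) * (1 - s) * (2 * c + 1) / (2 * c + 2 - T)) (q ^ 2 * (1 - s) ^ 2 * c / (c + 2 - T)) (2 * q * (1 - q) * s * (c + 1) / T)
    ((c + 2) * q ^ 2 * (1 - s) * (2 * s * (c + 2 - T) - (1 - s) * (T - 2)) / (T * (c + 2 - T)))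
    ?_ ?_ ?_ ?_ ?_ ?_ m0 m3 m4 m5 m6 fun h => ?_
  · refine div_nonneg (mul_nonneg (mul_nonneg (by positivity) hq0.le) ?_) (mul_pos hTpos hW).le
    rw [hTdef]; linarith
  · exact div_nonneg (mul_nonneg (mul_nonneg (mul_nonneg (by positivity) (by linarith)) (by linarith)) (by positivity)) hW.le
  · exact div_nonneg (mul_nonneg (mul_nonneg (sq_nonneg q) (sq_nonneg _)) hc0'.le) hV.le
  · exact div_nonneg (mul_nonneg (mul_nonneg (mul_nonneg (by positivity) (by linarith)) hs0.le) (by positivity)) hTpos.le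
  · refine div_nonneg (mul_nonneg (mul_nonneg (by positivity) (by linarith)) ?_) (mul_pos hTpos hV).le
    rw [hTdef]; linarith
  · have hW' : (2 : ℝ) * c + 2 - T ≠ 0 := hW.ne'
    have hV' : (c : ℝ) + 2 - T ≠ 0 := hV.ne'
    have hT' : T ≠ 0 := hTpos.ne'
    rw [hTdef] at hW' hV' hT' ⊢
    exact bfTop_wsum c q s hT' hW' hV'
  · exact lpT_eq_bfTopMix c q s hc0 hTpos.ne' hW.ne' hV.ne' h

/-- **… hence at every floor `0 < x ≤ qs`**, with the mean written as the law's own first moment. [this work] -/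
theorem lpT_inGatedCatHull_bfTop_below (c : ℕ) (q s : ℝ) (hc : 1 ≤ c) (hq : 1 / 2 < q) (hq1 : q < 1) (hs0 : 0 < s) (hs1 : s < 1)
    (hT : 2 * q * (1 + c * s) ≤ c + 1) (hB : q * s ≤ 2 * q - 1) (hE : 2 * (1 - q) ≤ c * (q * s))
    (hw2 : (1 - s) * (2 * q * (1 + c * s) - 2) ≤ 2 * s * (c + 2 - 2 * q * (1 + c * s)))
    (hw6 : 2 * (1 - q) * (1 - s) * (2 * q * (1 + c * s) - 1) ≤ q * s ^ 2 * (2 * c + 2 - 2 * q * (1 + c * s)))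
    (x : ℝ) (hx0 : 0 < x) (hx : x ≤ q * s) :
    InGatedCatHull x (∑ h ∈ Finset.range (2 * c + 2 + 1), (h : ℝ) * lpT c q s h) (2 * c + 2) (lpT c q s) := by
  rw [lpT_mean]
  exact (lpT_inGatedCatHull_bfTop c q s hc hq hq1 hs0 hs1 hT hB hE hw2 hw6).mono hx0 hx

/-- **SDEC at the natural floor** on `R_BFtop(c)`. [this work] -/
theorem sdec_lpT_bfTop (c : ℕ) (q s : ℝ) (hc : 1 ≤ c) (hq : 1 / 2 < q) (hq1 : q < 1) (hs0 : 0 < s) (hs1 : s < 1)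
    (hT : 2 * q * (1 + c * s) ≤ c + 1) (hB : q * s ≤ 2 * q - 1) (hE : 2 * (1 - q) ≤ c * (q * s))
    (hw2 : (1 - s) * (2 * q * (1 + c * s) - 2) ≤ 2 * s * (c + 2 - 2 * q * (1 + c * s)))
    (hw6 : 2 * (1 - q) * (1 - s) * (2 * q * (1 + c * s) - 1) ≤ q * s ^ 2 * (2 * c + 2 - 2 * q * (1 + c * s))) :
    SDEC (q * s) (2 * c + 2) (lpT c q s) :=
  sdec_of_inGatedCatHull (mul_pos (by linarith) hs0) (lpT_inGatedCatHull_bfTop c q s hc hq hq1 hs0 hs1 hT hB hE hw2 hw6)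

/-- **THE LIGHT NODE ON THESE LAWS**: every tree-built presentation `TreeBuilt x M T` at a floor `x ≤ qs` is in the hull at `x`, its own mean and
its own top. [this work] -/
theorem treeBuiltCatHull_lpT_bfTop (c : ℕ) (q s : ℝ) (hc : 1 ≤ c) (hq : 1 / 2 < q) (hq1 : q < 1) (hs0 : 0 < s) (hs1 : s < 1)
    (hT : 2 * q * (1 + c * s) ≤ c + 1) (hB : q * s ≤ 2 * q - 1) (hE : 2 * (1 - q) ≤ c * (q * s))
    (hw2 : (1 - s) * (2 * q * (1 + c * s) - 2) ≤ 2 * s * (c + 2 - 2 * q * (1 + c * s)))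
    (hw6 : 2 * (1 - q) * (1 - s) * (2 * q * (1 + c * s) - 1) ≤ q * s ^ 2 * (2 * c + 2 - 2 * q * (1 + c * s)))
    (x : ℝ) (M : ℕ) (hTB : TreeBuilt x M (lpT c q s)) (hx : x ≤ q * s) :
    InGatedCatHull x (∑ h ∈ Finset.range (M + 1), (h : ℝ) * lpT c q s h) M (lpT c q s) := by
  obtain ⟨hx0, hM⟩ := lpT_treeBuilt_top c q s (by linarith) hq1.le hs0 hs1.le hTB
  obtain ⟨a, rfl⟩ := Nat.exists_eq_add_of_le hM
  rw [sum_range_extend (fun h => (h : ℝ) * lpT c q s h) (2 * c + 2) a (fun h hh => by rw [lpT_eq_zero c q s h hh, mul_zero]),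
    lpT_mean]
  exact ((lpT_inGatedCatHull_bfTop c q s hc hq hq1 hs0 hs1 hT hB hE hw2 hw6).mono hx0 hx).mono_top hM

end LawDec
end Quant
end Summit.CriticalPhenomena.PercolationContinuityZ3.Theorems
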